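import Summits.ABC.IUTFork.Joshi.FundamentalEstimateBLStandard
import Summits.ABC.IUTFork.Joshi.ThetaJoshiConstruction
import HarnessLib

/-!
# [J-III] Thm. 7.3.1, the standard-point norm values `StandardPointNorms` — SUPPLIED from the §6.4 admissible-lift carrier:
# the Teichmüller-norm step DISCHARGED, the composite hypothesis reduced to two printed claims

Proof-only companion (abc-iut cell, block E «type Joshi's construction, test vs S», rung LADDER-ABC:A2.E; seat abc-iut-E-t10,
slot T-10) of `Joshi/FundamentalEstimateBLStandard.lean` (abc-iut-E-t12, slot T-12: `AdelicThetaDatum.StandardPointNorms`, the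
HYPOTHESIS «|Ξ^{α_w}_{0,z_Θ,w,j}|_{B_{L′_w},ρ} = |q_w|^{(1/2ℓ)(j²/ℓ*²)}` of the proof of [J-III] Thm. 7.3.1, p.56 l.22–45, which E-t12
names as the composite of three printed assertions and lists T-10 among its suppliers, STATUS 06:56:42Z) and of
`Joshi/ThetaJoshiConstruction.lean` (this seat, p428539: `ATS3.ThetaLiftDatum`, `IsTeichLift`, `admissibleLift` = Def. 6.4.3.1,
and the DERIVED `norm_teich_of_isTeichLift : |[z]|_ρ = |ξ_{1;K_{y′}}|_{K_{y′}}`). SOURCE: K. Joshi, arXiv:2401.13508 **v4**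
(unrefereed; bib `Joshi2024ATS3`; render `HOME/lit/renders/Joshi-arxiv-2401.13508/pNNNN.txt`, «p.N l.M» = PDF page N line M) and
arXiv:2303.01662v3 = [J-IIp] (bib `Joshi2023ATS2Local`). TAKES NO SIDE on [IUTchIII] Cor. 3.12, on Joshi's claims or on
Mochizuki's report; typed ≠ proved ≠ endorsed; object-side file (E-PLAN R14: imports Joshi object files only).

WHAT IS PROVED. `standardPointNorms_of_teichLifts`: if, at every `w ∈ 𝕍^{odd,ss}`, the ring `B_{L′_w}` of E-t12's datum carries a
§6.4 lift datum `L w : ThetaLiftDatum (O_{E′_w}) (B w) (Y w)` with the SAME Fréchet norms, and the distinguished element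
`Ξ^{α_w}_{0,z_Θ,w}` of Thm. 7.3.1's proof (p.55 l.36–66 «the set contains elements of the form Ξ^α_{λ,z} and especially …
Ξ^α_{0,z}»; p.56 l.29–37 «α_w is an ℓ*-tuple of Teichmüller lifts of the tuple (q_{w,j})_j … computed in the ℓ*-tuple of residue
fields (K_{y_{w,j}})_j») IS the `λ = 0` admissible lift `([z_{w,1}], …, [z_{w,ℓ*}])` of Def. 6.4.3.1 over the `w`-component of the
standard point, then `StandardPointNorms D` FOLLOWS from exactly two printed claims, taken as hypotheses and nothing else:
(VS) valuation scaling at the standard point, normalised at the last label — `|ξ_{1;K_{y′_{w,j}}}|_{K_{y′_{w,j}}} =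
|ξ_{1;K_{y′_{w,ℓ*}}}|_{K_{y′_{w,ℓ*}}}^{j²/ℓ*²}` ([J-III] Thm. 4.2.2.1 (4) p.33 l.3–36 «|−|_{K_{y′_{w,j}}} = |−|^{j²}_{K_{y′_{w,1}}}» read
between labels `j` and `ℓ*`, with §4.5 p.36 l.11–17: at `z_Θ` the last entry `y_{ℓ*} = y′_0` is the standard point, residue field
`ℂ_p` (Prop. 4.4.1); [J-IIp] (9.2.3) p.27 «v_{K_j}(p) = (j²/ℓ*²)·v_{ℂ_p}(p)»); (TS) theta-value size at the standard point —
`|ξ_{1;K_{y′_{w,ℓ*}}}|_{ℂ_{p_w}} = |q_w|_{ℂ_{p_w}}^{1/2ℓ}` ([J-IIp] §5.1 p.13 l.27–40 «|ξ_1| = |q^{1/2ℓ}|»; [J-III] p.56 l.29–37). The third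
ingredient E-t12 lists, [J-IIp] Prop. 7.4.2 «|[x]|_ρ = |x|_F = |ξ|_{K_y}», is NOT a hypothesis here: it is the theorem
`ThetaLiftDatum.norm_teich_of_isTeichLift` of p428539 (from the two Fargues–Fontaine fields of the carrier). Hence, through E-t12's
`fundamentalEstimateBL_of_standardPointNorms`, Joshi's Thm. 7.3.1 AS TYPED holds over (VS) ∧ (TS) ∧ «Ξ^α_{0,z_Θ} is the λ = 0
admissible lift» for every `ℓ ≥ 5` (`fundamentalEstimateBL_of_teichLifts`). No FACT-LIST row is consumed; no new `Prop` is
introduced (the hypotheses are stated inline at their point of use, each with its locator); nothing is asserted.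
-/

noncomputable section

namespace Summit.ABC.IUTFork.Joshi.ATS3

namespace AdelicThetaDatum

variable (D : AdelicThetaDatum)

/-- The last label `j = ℓ*` as an element of `Fin ℓ*` (index `ℓ* − 1`): the coordinate of the standard point `z_Θ = (y_1, …, y_{ℓ*})`
carrying `y_{ℓ*} = y′_0`, the standard point of `𝒴′_{L′}` ([J-III] §4.5 p.36 l.11–17), at which the valuations are normalised
(`K_{y_{ℓ*}} = ℂ_p`, Prop. 4.4.1 p.35 l.99–108). [claim: Joshi2024ATS3, status: disputed] -/
def lastLabel : Fin D.lstar := ⟨D.lstar - 1, by have := D.two_le_lstar; omega⟩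

/-- `(lastLabel : ℕ) + 1 = ℓ*`. [folklore] -/
theorem val_lastLabel_add_one : ((D.lastLabel : ℕ) : ℝ) + 1 = (D.lstar : ℝ) := by
  have h := D.two_le_lstar
  have : (D.lastLabel : ℕ) + 1 = D.lstar := by unfold lastLabel; dsimp; omega
  exact_mod_cast this

/-- The printed exponent at the last label is the base exponent `1/(2ℓ)` (`j²/ℓ*² = 1` at `j = ℓ*`). [folklore] -/
theorem stdExponent_lastLabel : D.stdExponent D.lastLabel = 1 / (2 * (D.ell : ℝ)) := by
  unfold stdExponent
  rw [D.val_lastLabel_add_one]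
  have h : (D.lstar : ℝ) ≠ 0 := by have := D.two_le_lstar; exact_mod_cast (by omega : D.lstar ≠ 0)
  rw [div_self (pow_ne_zero 2 h), mul_one]

/-- **`StandardPointNorms` SUPPLIED from §6.4 lift data.** Over E-t12's adelic datum `D`, suppose that at every `w ∈ 𝕍^{odd,ss}` the
ring `B_{L′_w}` carries a lift datum `L w` of [J-III] §6.4.2–§6.4.3 (`ATS3.ThetaLiftDatum`, p428539) with the same Fréchet norms
(`hnrm`), that the `w`-component `(y′_{w,1}, …, y′_{w,ℓ*})` of the standard point `z_Θ` and tilt elements `z_{w,j}` with `[z_{w,j}]` a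
Teichmüller lift of `ξ_{1;K_{y′_{w,j}}}` are given (`hz`, Def. 6.4.3.1 p.47 l.64–81), and that the distinguished element of the proof
of Thm. 7.3.1 is the `λ = 0` admissible lift over them (`hXi`: p.55 l.36–66, p.56 l.29–37 «Ξ^α_{0,z}», «α_w is an ℓ*-tuple of
Teichmüller lifts … computed in the residue fields (K_{y_{w,j}})_j»). THEN the printed norm values follow from the two printed claims
(VS) `hscale` — valuation scaling normalised at the last label, [J-III] Thm. 4.2.2.1 (4) p.33 l.31–36 with §4.5 p.36 l.11–17 /
[J-IIp] (9.2.3) p.27 — and (TS) `hq` — `|ξ_1|_{ℂ_p} = |q_w|^{1/2ℓ}` at the standard residue field, [J-IIp] §5.1 p.13 l.27–40 / [J-III]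
p.56 l.29–37 —, the step `|[z]|_ρ = |ξ|_{K_{y′}}` ([J-IIp] Prop. 7.4.2) being the theorem `norm_teich_of_isTeichLift`. Kernel glue; no
claim of Joshi's is asserted. [claim: Joshi2024ATS3, status: disputed] -/
theorem standardPointNorms_of_teichLifts {OE : D.W → Type*} [∀ w, CommRing (OE w)] [∀ w, CommRing (D.B w)]
    [∀ w, Algebra (OE w) (D.B w)] {Y : D.W → Type*} (L : ∀ w, ThetaLiftDatum (OE w) (D.B w) (Y w))
    (hnrm : ∀ w ∈ D.Vss, ∀ (ρ : ℝ) (x : D.B w), (L w).norm ρ x = D.nrm w ρ x)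
    (y : ∀ w, Fin D.lstar → Y w) (z : ∀ w, Fin D.lstar → (L w).Cflat)
    (hz : ∀ w ∈ D.Vss, ∀ i : Fin D.lstar, (L w).IsTeichLift (y w i) (z w i))
    (hXi : ∀ w ∈ D.Vss, D.Xi D.std w = (L w).admissibleLift (y w) (z w) (0 : OE w))
    (hscale : ∀ w ∈ D.Vss, ∀ i : Fin D.lstar, (L w).absK (y w i) ((L w).xi (y w i)) =
      (L w).absK (y w D.lastLabel) ((L w).xi (y w D.lastLabel)) ^ (((((i : ℕ) : ℝ) + 1) ^ 2) / ((D.lstar : ℝ) ^ 2)))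
    (hq : ∀ w ∈ D.Vss, (L w).absK (y w D.lastLabel) ((L w).xi (y w D.lastLabel)) = D.qAbs w ^ (1 / (2 * (D.ell : ℝ)))) :
    D.StandardPointNorms := by
  intro w hw ρ hρ i
  have hcoord : D.Xi D.std w i = (L w).teich (z w i) := by
    rw [hXi w hw]
    simp [ThetaLiftDatum.admissibleLift]
  rw [hcoord, ← hnrm w hw ρ _, (L w).norm_teich_of_isTeichLift (hz w hw i) hρ.1 hρ.2, hscale w hw i, hq w hw,
    ← Real.rpow_mul (D.qAbs_pos w hw).le]
  rfl

/-- **Thm. 7.3.1 AS TYPED (`FundamentalEstimateBL`) over the §6.4 lift data**, for every `ℓ ≥ 5`: compose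
`standardPointNorms_of_teichLifts` with E-t12's `fundamentalEstimateBL_of_standardPointNorms`. Its hypothesis set is therefore
(VS) ∧ (TS) ∧ «the distinguished element is the λ = 0 admissible lift of Teichmüller lifts» ∧ «same norms» — all named above with
their locators; the Teichmüller-norm identity is discharged. Kernel glue only. [claim: Joshi2024ATS3, status: disputed] -/
theorem fundamentalEstimateBL_of_teichLifts {OE : D.W → Type*} [∀ w, CommRing (OE w)] [∀ w, CommRing (D.B w)]
    [∀ w, Algebra (OE w) (D.B w)] {Y : D.W → Type*} (L : ∀ w, ThetaLiftDatum (OE w) (D.B w) (Y w))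
    (hnrm : ∀ w ∈ D.Vss, ∀ (ρ : ℝ) (x : D.B w), (L w).norm ρ x = D.nrm w ρ x)
    (y : ∀ w, Fin D.lstar → Y w) (z : ∀ w, Fin D.lstar → (L w).Cflat)
    (hz : ∀ w ∈ D.Vss, ∀ i : Fin D.lstar, (L w).IsTeichLift (y w i) (z w i))
    (hXi : ∀ w ∈ D.Vss, D.Xi D.std w = (L w).admissibleLift (y w) (z w) (0 : OE w))
    (hscale : ∀ w ∈ D.Vss, ∀ i : Fin D.lstar, (L w).absK (y w i) ((L w).xi (y w i)) =
      (L w).absK (y w D.lastLabel) ((L w).xi (y w D.lastLabel)) ^ (((((i : ℕ) : ℝ) + 1) ^ 2) / ((D.lstar : ℝ) ^ 2)))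
    (hq : ∀ w ∈ D.Vss, (L w).absK (y w D.lastLabel) ((L w).xi (y w D.lastLabel)) = D.qAbs w ^ (1 / (2 * (D.ell : ℝ)))) :
    D.FundamentalEstimateBL :=
  D.fundamentalEstimateBL_of_standardPointNorms (D.standardPointNorms_of_teichLifts L hnrm y z hz hXi hscale hq)

/-- Consistency of (VS) at the last label: there the scaling hypothesis is the tautology `a = a ^ 1` — so (VS) constrains only the
labels `j < ℓ*`, as in print (the normalisation `K_{y_{ℓ*}} = ℂ_p`). [folklore] -/
theorem scale_lastLabel_trivial (a : ℝ) :
    a = a ^ (((((D.lastLabel : ℕ) : ℝ) + 1) ^ 2) / ((D.lstar : ℝ) ^ 2)) := by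
  rw [D.val_lastLabel_add_one]
  have h : (D.lstar : ℝ) ≠ 0 := by have := D.two_le_lstar; exact_mod_cast (by omega : D.lstar ≠ 0)
  rw [div_self (pow_ne_zero 2 h), Real.rpow_one]

/-- At the last label the supplied norm is `|q_w|^{1/2ℓ}` itself (the q-side size that Thm. 7.3.1's right-hand side raises to the
power `ℓ*`): `StandardPointNorms` there reads `|Ξ_{ℓ*}|_ρ = |q_w|^{1/2ℓ}`. [claim: Joshi2024ATS3, status: disputed] -/
theorem standardPointNorms_lastLabel (h : D.StandardPointNorms) {w : D.W} (hw : w ∈ D.Vss) {ρ : ℝ}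
    (hρ : ρ ∈ Set.Ioc (0 : ℝ) 1) : D.nrm w ρ (D.Xi D.std w D.lastLabel) = D.qAbs w ^ (1 / (2 * (D.ell : ℝ))) := by
  rw [h w hw ρ hρ, D.stdExponent_lastLabel]

end AdelicThetaDatum

end Summit.ABC.IUTFork.Joshi.ATS3

end
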